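import Summits.BirchSwinnertonDyer.Rank1Residual.Partition.CornersFiveLeCertificates
import Summits.BirchSwinnertonDyer.Rank1Residual.Partition.CornersMultDatum
import HarnessLib

/-!
# `p ≥ 5`, 'good ORDINARY, or MULTIPLICATIVE', analytic rank `≤ 1` — the ELEVENTH and TWELFTH joint
# closing forms in DATUM currency: the Kubota–Leopoldt existence binder `hEx` (A223) DISCHARGED by
# the tree's theorem and the curve-level GV (5)–(7) binder `hΛ` (A133) RE-THREADED through the
# Greenberg–Vatsal §2 datum records T-GV23L + A137′ (cell `b2b-bsdres`, RESIDUAL-MAP.md §A / §C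
# joint corner predicates; rmap-1 gen 10, after eisenstein-p2 gen 26's `X2/ClassClosureOfDatum`
# p297066 and this seat's `Partition/CornersMultDatum` p297925)

HONEST FRAMING (run/shared/lean/b2b/bsd-rank1-residual/, verbatim in every file): the goal of the
cell is to DELETE the COMBINATION-SHAPED residual classes of the Birch–Swinnerton-Dyer formula for
ALL analytic-rank `≤ 1` elliptic curves over `ℚ` — "full BSD formula for every rank `≤ 1` curve in
class `C`" assembled STRICTLY from published theorems — so that the rank-`≤ 1` remainder becomes
exactly the CONSTRUCTION-SHAPED classes, which are TYPED (missing-input `Prop`s), NOT attempted.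
This is not "finishing BSD". Theorems only; NO definition, NO named fact introduced here; every
published theorem enters as one of the tree's existing named Literature facts BY NAME; every
per-pair input is an explicit hypothesis asked ONLY on the cells that use it; nothing about any
particular curve is asserted; no label changes (X11a stays NEEDS X_C1, X11b stays NEEDS X_C2 /
CONSTRUCTION-SHAPED, X1 / X2 / X9 marks unchanged); nothing is booked by this file; census and
instrument rows are EVIDENCE — their tier is referee A's and the lane's. The class-level statements
behind the per-pair binders are Greenberg's `μ`-conjecture and Schneider's conjecture (OPEN, NAMED,
typed), NEVER asserted here.

## What this file records

`Partition/CornersFiveLeAfterClosures.lean` (p269647, ELEVENTH form, thirty-one named facts) and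
`Partition/CornersFiveLeCertificates.lean` (p276143, TWELFTH form, forty named facts) both carry, in
their multiplicative X2 branch, two binders that the tree has since moved: `hEx :
exists_characterLFunction` (registry A223 — a THEOREM since eisenstein-p2 gen 23,
`GreenbergVatsal2000.exists_characterLFunction_holds`) and `hΛ :
lambda_nonPrimitive_eq_add_sum_delta_multiplicative` (registry A133 — DERIVED since eisenstein-p2
gen 26 from the §2 datum records: `X2.NonPrimitiveLambdaInvariantMultiplicativeDerived.
lambda_nonPrimitive_eq_add_sum_delta_multiplicative_of_datum : T-GV23L → A40 → A41 → A137′ → A133`).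
This file restates both joint forms with those two binders so fed — `hEx` gone, `hΛ` replaced by
`h23 : datumSelmer_nonPrimitive_invariants` (GV Prop. (2.1) / Cor. (2.3) / Prop. (2.4)) and
`hInf : datumStrictSelmer_relIndex_eq_zero_of_split` (GV p. 15 with p. 20); `hT` / `hT'` were already
binders — and nothing else changed:

* `bsdp_goodOrd_or_mult_of_five_le_rankLeOne_after_closures_of_datum` — the ELEVENTH form in datum
  currency: thirty-one named facts (−A223 −A133 +T-GV23L +A137′), same per-pair hypotheses, same
  corner `(X1 ∧ ¬gvpar) ∨ X11a ∨ (X2 ∧ ¬(r = 0 ∧ gvpar) ∧ ¬(r = 1 ∧ ¬split ∧ gvpar)) ∨ (X11b ∧ ¬Ram)`;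
  partition form `bsdp_or_corner_goodOrd_or_mult_of_five_le_after_closures_of_datum`;
* `bsdp_goodOrd_or_mult_of_five_le_rankLeOne_certificates_of_datum` — the TWELFTH form in datum
  currency: forty named facts (−A223 −A133 +T-GV23L +A137′), same per-pair certificate binders of
  record (`hcert1`, `hμ9`, `hcert9`, `hSch9`, `hSchN`, `hSchS`, `hμ11`), same corner
  `(X1 ∧ ¬gvpar) ∨ (X11a ∧ ¬surj) ∨ (X2 ∧ …) ∨ (X11b ∧ ¬Ram ∧ (¬surj ∨ (split ∧ no second
  multiplicative prime)))`; partition form `bsdp_or_corner_goodOrd_or_mult_of_five_le_certificates_of_datum`.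

Bookkeeping only (each proof is the gen-9 theorem applied to the two derived terms); which binder
set is "of record" for the registry is lit's / the b2b referee's call, not this file's. No mark
moves; nothing is booked.

References: RESIDUAL-MAP.md §A / §C corner predicates (ELEVENTH / TWELFTH forms, rmap-1 gen 9);
`X2/ClassClosureOfDatum.lean` (p297066); `Partition/CornersMultDatum.lean` (p297925);
[GreenbergVatsal2000] Thm. (1.3), §2 Prop. (2.1), Cor. (2.3), Prop. (2.4), pp. 14–15, 20, §3
Thm. (3.11); [Skinner2016PacificMC] Thm. A, Thm. C; [SteinWuthrich2013] Thm. 6.1, §4.2;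
[Disegni2020] Thm. 1; [EmertonPollackWeston2006] Thm. 1, 3.1.1, 5.1.3; [Wan2015] Thm. 4; referee A
ROUND 199 R199.2 / ROUND 201 R201.2.
-/

noncomputable section

open scoped Classical MatrixGroups ModularForm NumberField

namespace Summit.BirchSwinnertonDyer.Rank1Residual

open CongruenceSubgroup WeierstrassCurve PowerSeries Literature.NumberTheory.EllipticCurves
  Literature.NumberTheory.EllipticCurves.Rank1Residual Literature.NumberTheory.EllipticCurves.ModularForms
  Literature.NumberTheory.EllipticCurves.Wuthrich2014
  Literature.NumberTheory.EllipticCurves.GreenbergVatsal2000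
  Literature.NumberTheory.EllipticCurves.Rank1Residual.Typed
  Literature.NumberTheory.EllipticCurves.Skinner2016
  Literature.NumberTheory.EllipticCurves.SteinWuthrich2013
  Literature.NumberTheory.EllipticCurves.Disegni2020
  Literature.NumberTheory.EllipticCurves.EmertonPollackWeston2006

section Curve

variable {W : WeierstrassCurve ℚ} [W.IsElliptic] [W.IsGloballyMinimal] {p : ℕ} [Fact p.Prime]

/-! ### The ELEVENTH form in datum currency -/

/-- **Non-CM, `p ≥ 5`, 'good ORDINARY, or MULTIPLICATIVE', analytic rank `≤ 1`, after the X2a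
closure and in Riemann-sum currency — DATUM form: THIRTY-ONE named facts** (the ELEVENTH form
`bsdp_goodOrd_or_mult_of_five_le_rankLeOne_after_closures` with `hEx` supplied by
`exists_characterLFunction_holds` and `hΛ` by
`lambda_nonPrimitive_eq_add_sum_delta_multiplicative_of_datum h23 hT hT' hInf`). `BSD(E,p)` unless
`(X1 ∧ ¬gvpar) ∨ X11a ∨ (X2 ∧ ¬(r = 0 ∧ gvpar) ∧ ¬(r = 1 ∧ ¬split ∧ gvpar)) ∨ (X11b ∧ ¬Ram)`, granted
the per-pair hypotheses each only where used. [folklore] -/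
theorem bsdp_goodOrd_or_mult_of_five_le_rankLeOne_after_closures_of_datum
    (hBCS : BurungaleCastellaSkinner2025.cor131_padicValRat_bsd_rank_le_one)
    (hBCSa : burungale_castella_skinner_charIdeal_eq_padicLFunction)
    (hGZK : rank_eq_analyticRank_of_analyticRank_le_one)
    (hCGS : CastellaGrossiSkinner2025.thmD_padicValRat_bsd_rank_le_one)
    (hGVg : GreenbergVatsal2000.thm13_charIdeal_eq_of_gvPar) (hGr : greenberg_charValue_rankZero)
    (hmod : hasEntireLFunction_rat) (hmodP : nonempty_modularParametrizationData)
    (hS : Schneider1985_order_charGenerator) (hPR : perrinRiou_rankOne_leadingTerms)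
    (hΩ : realPeriodRat_eq_unit_mul_plusPeriod)
    (hSk : Skinner2016.thmC_padicValRat_bsd_rank_zero) (hA : thmA_charIdeal_multiplicative)
    (hD : thm1_padicBSD_rankOne_multiplicative)
    (h23 : datumSelmer_nonPrimitive_invariants)
    (hInf : datumStrictSelmer_relIndex_eq_zero_of_split)
    (hT : Silverman1994_thmV53_tateUniformisation.{0})
    (hT' : Silverman1994_thmV53_corV54_tateUniformisation.{0})
    (hB : datumSelmer_divisible_of_finite_torsionBy)
    (hF : datumStrictSelmer_lt_datumSelmer_of_split)
    (hLiftF : residualEpsilon_surjOn_of_lineRamifiedEven)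
    (hP : cor38_realPeriodRat_eq_unit_mul_of_isIsogenous_of_gvPar)
    (h311 : thm311_hasUnitContent_iff_and_order_eq_of_lineRamifiedEven)
    (hLC : characterLFunctionC_hasUnitContent_and_order_eq_card)
    (hLD : characterLFunctionD_hasUnitContent_and_order_eq_card)
    (hWu : thm16_charIdeal_dvd_multiplicative_of_reducible)
    (hJs : thm61_splitMultiplicative) (hJn : thm61_nonsplitMultiplicative)
    (hHs : exists_isSplitMultCanonical) (hHn : exists_isMultCanonical)
    (hGS : ∀ (W : WeierstrassCurve ℚ) [W.IsElliptic] [W.IsGloballyMinimal] (p : ℕ) [Fact p.Prime],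
      greenberg_stevens (W := W) (p := p))
    (hcm : ¬ W.HasCM) (hr : W.analyticRank ≤ 1) (h5 : 5 ≤ p) (hdom : GoodOrd W p ∨ Mult W p)
    (hcert1 : ClassX1 W p → GVPar W p →
      ∃ (N : ℕ) (_ : NeZero N) (f : CuspForm (Gamma0 N) 2), IsNewformOf W f ∧
        ∃ (C : ℝ) (n : ℕ), (∀ (m : ℕ) (a : ZMod (p ^ m)), ‖msdMeasure f (unitRoot W p : ℚ_[p]) m a‖ ≤ C) ∧
          C * (p : ℝ) ^ (-n : ℤ) < ‖padicLRiemannSum f (unitRoot W p : ℚ_[p]) 1 n‖)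
    (hμ : ClassX9 W p → ∀ (κ : ZpExtension ℚ p) (γ : Field.absoluteGaloisGroup ℚ),
        κ.IsCyclotomic → κ.IsTopGenerator γ → IsCyclotomicVariable p γ →
      ∀ (D : W.SelmerDualData κ γ), D.mu = 0)
    (hcert9 : ClassX9 W p → ∀ [NeZero (W.conductorNorm ℤ)]
        (f : CuspForm (CongruenceSubgroup.Gamma0 (W.conductorNorm ℤ)) 2),
        IsNewformOf W f → ∀ (ϖ : ℚ), (ϖ : ℝ) * W.realPeriodRat = plusPeriod f →
      ∃ n : ℕ, ‖PowerSeries.coeff n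
        (PowerSeries.C (ϖ : ℚ_[p]) * padicLFunction f (unitRoot W p : ℚ_[p]))‖ = 1)
    (hSch9 : ClassX9 W p → ∀ Dh : PAdicHeightData W p, Dh.IsCanonical → SchneiderConjecture Dh)
    (hSchN : ∀ (q : ℚ_[p]) (Dh : PAdicHeightData W p), q ≠ 0 → ‖q‖ < 1 → tateJ q = (W.j : ℚ_[p]) →
      IsMultCanonical Dh q → SchneiderConjecture Dh)
    (hSchS : ∀ (Dq : TateParameterData W p) (Dh : PAdicHeightData W p),
      IsSplitMultCanonical Dh Dq → SchneiderConjecture Dh)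
    (hA1 : ¬ (ClassX1 W p ∧ ¬ GVPar W p)) (hX11a : ¬ ClassX11a W p)
    (hX2 : ¬ (ClassX2 W p ∧ ¬ (W.analyticRank = 0 ∧ GVPar W p) ∧
      ¬ (W.analyticRank = 1 ∧ ¬ W.HasSplitMultiplicativeReductionAtPrime p ∧ GVPar W p)))
    (hX11b : ¬ (ClassX11b W p ∧ ¬ Ram W p)) : BSDp W p :=
  bsdp_goodOrd_or_mult_of_five_le_rankLeOne_after_closures hBCS hBCSa hGZK hCGS hGVg hGr hmod hmodP hS
    hPR hΩ hSk hA hD hT hT'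
    (X2.NonPrimitiveLambdaInvariantMultiplicativeDerived.lambda_nonPrimitive_eq_add_sum_delta_multiplicative_of_datum
      h23 hT hT' hInf)
    hB hF hLiftF hP exists_characterLFunction_holds h311 hLC hLD hWu hJs hJn hHs hHn hGS hcm hr h5 hdom
    hcert1 hμ hcert9 hSch9 hSchN hSchS hA1 hX11a hX2 hX11b

/-- **Partition form of the ELEVENTH form in datum currency:
`BSD(E,p) ∨ (X1 ∧ ¬gvpar) ∨ X11a ∨ (X2 ∧ ¬(r = 0 ∧ gvpar) ∧ ¬(r = 1 ∧ ¬split ∧ gvpar)) ∨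
(X11b ∧ ¬Ram)`** from the same thirty-one named facts and per-pair hypotheses. [folklore] -/
theorem bsdp_or_corner_goodOrd_or_mult_of_five_le_after_closures_of_datum
    (hBCS : BurungaleCastellaSkinner2025.cor131_padicValRat_bsd_rank_le_one)
    (hBCSa : burungale_castella_skinner_charIdeal_eq_padicLFunction)
    (hGZK : rank_eq_analyticRank_of_analyticRank_le_one)
    (hCGS : CastellaGrossiSkinner2025.thmD_padicValRat_bsd_rank_le_one)
    (hGVg : GreenbergVatsal2000.thm13_charIdeal_eq_of_gvPar) (hGr : greenberg_charValue_rankZero)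
    (hmod : hasEntireLFunction_rat) (hmodP : nonempty_modularParametrizationData)
    (hS : Schneider1985_order_charGenerator) (hPR : perrinRiou_rankOne_leadingTerms)
    (hΩ : realPeriodRat_eq_unit_mul_plusPeriod)
    (hSk : Skinner2016.thmC_padicValRat_bsd_rank_zero) (hA : thmA_charIdeal_multiplicative)
    (hD : thm1_padicBSD_rankOne_multiplicative)
    (h23 : datumSelmer_nonPrimitive_invariants)
    (hInf : datumStrictSelmer_relIndex_eq_zero_of_split)
    (hT : Silverman1994_thmV53_tateUniformisation.{0})
    (hT' : Silverman1994_thmV53_corV54_tateUniformisation.{0})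
    (hB : datumSelmer_divisible_of_finite_torsionBy)
    (hF : datumStrictSelmer_lt_datumSelmer_of_split)
    (hLiftF : residualEpsilon_surjOn_of_lineRamifiedEven)
    (hP : cor38_realPeriodRat_eq_unit_mul_of_isIsogenous_of_gvPar)
    (h311 : thm311_hasUnitContent_iff_and_order_eq_of_lineRamifiedEven)
    (hLC : characterLFunctionC_hasUnitContent_and_order_eq_card)
    (hLD : characterLFunctionD_hasUnitContent_and_order_eq_card)
    (hWu : thm16_charIdeal_dvd_multiplicative_of_reducible)
    (hJs : thm61_splitMultiplicative) (hJn : thm61_nonsplitMultiplicative)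
    (hHs : exists_isSplitMultCanonical) (hHn : exists_isMultCanonical)
    (hGS : ∀ (W : WeierstrassCurve ℚ) [W.IsElliptic] [W.IsGloballyMinimal] (p : ℕ) [Fact p.Prime],
      greenberg_stevens (W := W) (p := p))
    (hcm : ¬ W.HasCM) (hr : W.analyticRank ≤ 1) (h5 : 5 ≤ p) (hdom : GoodOrd W p ∨ Mult W p)
    (hcert1 : ClassX1 W p → GVPar W p →
      ∃ (N : ℕ) (_ : NeZero N) (f : CuspForm (Gamma0 N) 2), IsNewformOf W f ∧
        ∃ (C : ℝ) (n : ℕ), (∀ (m : ℕ) (a : ZMod (p ^ m)), ‖msdMeasure f (unitRoot W p : ℚ_[p]) m a‖ ≤ C) ∧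
          C * (p : ℝ) ^ (-n : ℤ) < ‖padicLRiemannSum f (unitRoot W p : ℚ_[p]) 1 n‖)
    (hμ : ClassX9 W p → ∀ (κ : ZpExtension ℚ p) (γ : Field.absoluteGaloisGroup ℚ),
        κ.IsCyclotomic → κ.IsTopGenerator γ → IsCyclotomicVariable p γ →
      ∀ (D : W.SelmerDualData κ γ), D.mu = 0)
    (hcert9 : ClassX9 W p → ∀ [NeZero (W.conductorNorm ℤ)]
        (f : CuspForm (CongruenceSubgroup.Gamma0 (W.conductorNorm ℤ)) 2),
        IsNewformOf W f → ∀ (ϖ : ℚ), (ϖ : ℝ) * W.realPeriodRat = plusPeriod f →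
      ∃ n : ℕ, ‖PowerSeries.coeff n
        (PowerSeries.C (ϖ : ℚ_[p]) * padicLFunction f (unitRoot W p : ℚ_[p]))‖ = 1)
    (hSch9 : ClassX9 W p → ∀ Dh : PAdicHeightData W p, Dh.IsCanonical → SchneiderConjecture Dh)
    (hSchN : ∀ (q : ℚ_[p]) (Dh : PAdicHeightData W p), q ≠ 0 → ‖q‖ < 1 → tateJ q = (W.j : ℚ_[p]) →
      IsMultCanonical Dh q → SchneiderConjecture Dh)
    (hSchS : ∀ (Dq : TateParameterData W p) (Dh : PAdicHeightData W p),
      IsSplitMultCanonical Dh Dq → SchneiderConjecture Dh) :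
    BSDp W p ∨ (ClassX1 W p ∧ ¬ GVPar W p) ∨ ClassX11a W p ∨
      (ClassX2 W p ∧ ¬ (W.analyticRank = 0 ∧ GVPar W p) ∧
        ¬ (W.analyticRank = 1 ∧ ¬ W.HasSplitMultiplicativeReductionAtPrime p ∧ GVPar W p)) ∨
      (ClassX11b W p ∧ ¬ Ram W p) :=
  bsdp_or_corner_goodOrd_or_mult_of_five_le_after_closures hBCS hBCSa hGZK hCGS hGVg hGr hmod hmodP hS
    hPR hΩ hSk hA hD hT hT'
    (X2.NonPrimitiveLambdaInvariantMultiplicativeDerived.lambda_nonPrimitive_eq_add_sum_delta_multiplicative_of_datum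
      h23 hT hT' hInf)
    hB hF hLiftF hP exists_characterLFunction_holds h311 hLC hLD hWu hJs hJn hHs hHn hGS hcm hr h5 hdom
    hcert1 hμ hcert9 hSch9 hSchN hSchS

/-! ### The TWELFTH form in datum currency -/

/-- **Non-CM, `p ≥ 5`, 'good ORDINARY, or MULTIPLICATIVE', analytic rank `≤ 1`, modulo the
per-pair certificate binders of record — DATUM form: FORTY named facts** (the TWELFTH form
`bsdp_goodOrd_or_mult_of_five_le_rankLeOne_certificates` with `hEx` supplied by
`exists_characterLFunction_holds` and `hΛ` by
`lambda_nonPrimitive_eq_add_sum_delta_multiplicative_of_datum h23 hT hT' hInf`). `BSD(E,p)` unless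
`(X1 ∧ ¬gvpar) ∨ (X11a ∧ ¬surj) ∨ (X2 ∧ ¬(r = 0 ∧ gvpar) ∧ ¬(r = 1 ∧ ¬split ∧ gvpar)) ∨
(X11b ∧ ¬Ram ∧ (¬surj ∨ (split ∧ no second multiplicative prime)))`, granted the per-pair
certificate binders each only where used. [folklore] -/
theorem bsdp_goodOrd_or_mult_of_five_le_rankLeOne_certificates_of_datum
    (hBCS : BurungaleCastellaSkinner2025.cor131_padicValRat_bsd_rank_le_one)
    (hBCSa : burungale_castella_skinner_charIdeal_eq_padicLFunction)
    (hGZK : rank_eq_analyticRank_of_analyticRank_le_one)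
    (hCGS : CastellaGrossiSkinner2025.thmD_padicValRat_bsd_rank_le_one)
    (hGVg : GreenbergVatsal2000.thm13_charIdeal_eq_of_gvPar) (hGr : greenberg_charValue_rankZero)
    (hmod : hasEntireLFunction_rat) (hmodP : nonempty_modularParametrizationData)
    (hS : Schneider1985_order_charGenerator) (hPR : perrinRiou_rankOne_leadingTerms)
    (hΩ : realPeriodRat_eq_unit_mul_plusPeriod)
    (hSk : Skinner2016.thmC_padicValRat_bsd_rank_zero) (hA : thmA_charIdeal_multiplicative)
    (hD : thm1_padicBSD_rankOne_multiplicative)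
    (h23 : datumSelmer_nonPrimitive_invariants)
    (hInf : datumStrictSelmer_relIndex_eq_zero_of_split)
    (hT : Silverman1994_thmV53_tateUniformisation.{0})
    (hT' : Silverman1994_thmV53_corV54_tateUniformisation.{0})
    (hB : datumSelmer_divisible_of_finite_torsionBy)
    (hF : datumStrictSelmer_lt_datumSelmer_of_split)
    (hLiftF : residualEpsilon_surjOn_of_lineRamifiedEven)
    (hP : cor38_realPeriodRat_eq_unit_mul_of_isIsogenous_of_gvPar)
    (h311 : thm311_hasUnitContent_iff_and_order_eq_of_lineRamifiedEven)
    (hLC : characterLFunctionC_hasUnitContent_and_order_eq_card)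
    (hLD : characterLFunctionD_hasUnitContent_and_order_eq_card)
    (hWu : thm16_charIdeal_dvd_multiplicative_of_reducible)
    (hJs : thm61_splitMultiplicative) (hJn : thm61_nonsplitMultiplicative)
    (hHs : exists_isSplitMultCanonical) (hHn : exists_isMultCanonical)
    (hGS : ∀ (W : WeierstrassCurve ℚ) [W.IsElliptic] [W.IsGloballyMinimal] (p : ℕ) [Fact p.Prime],
      greenberg_stevens (W := W) (p := p))
    (hHida : hida_exists_congruent_ordinary_newform_of_multiplicative)
    (hMTT : exists_isCycPAdicLFunctionWeightK)
    (h311e : thm311_cotorsion_weightK_member) (hT1a : thm1_muAlg_of_weightK_member)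
    (hT2 : Wan2015.thm4_rational_weightK_member_of_bdd)
    (hT1b : thm513_transfer_from_weightK_member_of_bdd)
    (h61 : DeligneSerre1974.thm61_exists_adicGaloisRep) (h326 : Hida2000_thm326_ordinary)
    (hKato : kato_charIdeal_dvd_multiplicative_of_surjective)
    (hcm : ¬ W.HasCM) (hr : W.analyticRank ≤ 1) (h5 : 5 ≤ p) (hdom : GoodOrd W p ∨ Mult W p)
    (hcert1 : ClassX1 W p → GVPar W p →
      ∃ (N : ℕ) (_ : NeZero N) (f : CuspForm (Gamma0 N) 2), IsNewformOf W f ∧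
        ∃ n : ℕ, (p : ℝ) ^ (-n : ℤ) < ‖padicLRiemannSum f (unitRoot W p : ℚ_[p]) 1 n‖)
    (hμ9 : ClassX9 W p → ∀ (κ : ZpExtension ℚ p) (γ : Field.absoluteGaloisGroup ℚ),
        κ.IsCyclotomic → κ.IsTopGenerator γ → IsCyclotomicVariable p γ →
      ∀ (D : W.SelmerDualData κ γ), D.mu = 0)
    (hcert9 : ClassX9 W p → ∀ [NeZero (W.conductorNorm ℤ)]
        (f : CuspForm (CongruenceSubgroup.Gamma0 (W.conductorNorm ℤ)) 2),
        IsNewformOf W f → ∀ (ϖ : ℚ), (ϖ : ℝ) * W.realPeriodRat = plusPeriod f →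
      ∃ n : ℕ, ‖PowerSeries.coeff n
        (PowerSeries.C (ϖ : ℚ_[p]) * padicLFunction f (unitRoot W p : ℚ_[p]))‖ = 1)
    (hSch9 : ClassX9 W p → ∀ Dh : PAdicHeightData W p, Dh.IsCanonical → SchneiderConjecture Dh)
    (hSchN : ∀ (q : ℚ_[p]) (Dh : PAdicHeightData W p), q ≠ 0 → ‖q‖ < 1 → tateJ q = (W.j : ℚ_[p]) →
      IsMultCanonical Dh q → SchneiderConjecture Dh)
    (hSchS : ∀ (Dq : TateParameterData W p) (Dh : PAdicHeightData W p),
      IsSplitMultCanonical Dh Dq → SchneiderConjecture Dh)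
    (hμ11 : ClassX11a W p ∨ (ClassX11b W p ∧ ¬ Ram W p) → Surj W p → X11a.MuAnZeroAt W p)
    (hA1 : ¬ (ClassX1 W p ∧ ¬ GVPar W p)) (hX11a : ¬ (ClassX11a W p ∧ ¬ Surj W p))
    (hX2 : ¬ (ClassX2 W p ∧ ¬ (W.analyticRank = 0 ∧ GVPar W p) ∧
      ¬ (W.analyticRank = 1 ∧ ¬ W.HasSplitMultiplicativeReductionAtPrime p ∧ GVPar W p)))
    (hX11b : ¬ (ClassX11b W p ∧ ¬ Ram W p ∧ (¬ Surj W p ∨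
      (W.HasSplitMultiplicativeReductionAtPrime p ∧
        ¬ ∃ (m : ℕ) (_ : Fact m.Prime), m ≠ p ∧ W.HasMultiplicativeReductionAtPrime m)))) :
    BSDp W p :=
  bsdp_goodOrd_or_mult_of_five_le_rankLeOne_certificates hBCS hBCSa hGZK hCGS hGVg hGr hmod hmodP hS hPR
    hΩ hSk hA hD hT hT'
    (X2.NonPrimitiveLambdaInvariantMultiplicativeDerived.lambda_nonPrimitive_eq_add_sum_delta_multiplicative_of_datum
      h23 hT hT' hInf)
    hB hF hLiftF hP exists_characterLFunction_holds h311 hLC hLD hWu hJs hJn hHs hHn hGS hHida hMTT h311e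
    hT1a hT2 hT1b h61 h326 hKato hcm hr h5 hdom hcert1 hμ9 hcert9 hSch9 hSchN hSchS hμ11 hA1 hX11a hX2
    hX11b

/-- **Partition form of the TWELFTH form in datum currency:
`BSD(E,p) ∨ (X1 ∧ ¬gvpar) ∨ (X11a ∧ ¬surj) ∨ (X2 ∧ ¬(r = 0 ∧ gvpar) ∧ ¬(r = 1 ∧ ¬split ∧ gvpar))
∨ (X11b ∧ ¬Ram ∧ (¬surj ∨ (split ∧ no second multiplicative prime)))`** from the same forty named
facts and per-pair hypotheses. [folklore] -/
theorem bsdp_or_corner_goodOrd_or_mult_of_five_le_certificates_of_datum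
    (hBCS : BurungaleCastellaSkinner2025.cor131_padicValRat_bsd_rank_le_one)
    (hBCSa : burungale_castella_skinner_charIdeal_eq_padicLFunction)
    (hGZK : rank_eq_analyticRank_of_analyticRank_le_one)
    (hCGS : CastellaGrossiSkinner2025.thmD_padicValRat_bsd_rank_le_one)
    (hGVg : GreenbergVatsal2000.thm13_charIdeal_eq_of_gvPar) (hGr : greenberg_charValue_rankZero)
    (hmod : hasEntireLFunction_rat) (hmodP : nonempty_modularParametrizationData)
    (hS : Schneider1985_order_charGenerator) (hPR : perrinRiou_rankOne_leadingTerms)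
    (hΩ : realPeriodRat_eq_unit_mul_plusPeriod)
    (hSk : Skinner2016.thmC_padicValRat_bsd_rank_zero) (hA : thmA_charIdeal_multiplicative)
    (hD : thm1_padicBSD_rankOne_multiplicative)
    (h23 : datumSelmer_nonPrimitive_invariants)
    (hInf : datumStrictSelmer_relIndex_eq_zero_of_split)
    (hT : Silverman1994_thmV53_tateUniformisation.{0})
    (hT' : Silverman1994_thmV53_corV54_tateUniformisation.{0})
    (hB : datumSelmer_divisible_of_finite_torsionBy)
    (hF : datumStrictSelmer_lt_datumSelmer_of_split)
    (hLiftF : residualEpsilon_surjOn_of_lineRamifiedEven)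
    (hP : cor38_realPeriodRat_eq_unit_mul_of_isIsogenous_of_gvPar)
    (h311 : thm311_hasUnitContent_iff_and_order_eq_of_lineRamifiedEven)
    (hLC : characterLFunctionC_hasUnitContent_and_order_eq_card)
    (hLD : characterLFunctionD_hasUnitContent_and_order_eq_card)
    (hWu : thm16_charIdeal_dvd_multiplicative_of_reducible)
    (hJs : thm61_splitMultiplicative) (hJn : thm61_nonsplitMultiplicative)
    (hHs : exists_isSplitMultCanonical) (hHn : exists_isMultCanonical)
    (hGS : ∀ (W : WeierstrassCurve ℚ) [W.IsElliptic] [W.IsGloballyMinimal] (p : ℕ) [Fact p.Prime],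
      greenberg_stevens (W := W) (p := p))
    (hHida : hida_exists_congruent_ordinary_newform_of_multiplicative)
    (hMTT : exists_isCycPAdicLFunctionWeightK)
    (h311e : thm311_cotorsion_weightK_member) (hT1a : thm1_muAlg_of_weightK_member)
    (hT2 : Wan2015.thm4_rational_weightK_member_of_bdd)
    (hT1b : thm513_transfer_from_weightK_member_of_bdd)
    (h61 : DeligneSerre1974.thm61_exists_adicGaloisRep) (h326 : Hida2000_thm326_ordinary)
    (hKato : kato_charIdeal_dvd_multiplicative_of_surjective)
    (hcm : ¬ W.HasCM) (hr : W.analyticRank ≤ 1) (h5 : 5 ≤ p) (hdom : GoodOrd W p ∨ Mult W p)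
    (hcert1 : ClassX1 W p → GVPar W p →
      ∃ (N : ℕ) (_ : NeZero N) (f : CuspForm (Gamma0 N) 2), IsNewformOf W f ∧
        ∃ n : ℕ, (p : ℝ) ^ (-n : ℤ) < ‖padicLRiemannSum f (unitRoot W p : ℚ_[p]) 1 n‖)
    (hμ9 : ClassX9 W p → ∀ (κ : ZpExtension ℚ p) (γ : Field.absoluteGaloisGroup ℚ),
        κ.IsCyclotomic → κ.IsTopGenerator γ → IsCyclotomicVariable p γ →
      ∀ (D : W.SelmerDualData κ γ), D.mu = 0)
    (hcert9 : ClassX9 W p → ∀ [NeZero (W.conductorNorm ℤ)]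
        (f : CuspForm (CongruenceSubgroup.Gamma0 (W.conductorNorm ℤ)) 2),
        IsNewformOf W f → ∀ (ϖ : ℚ), (ϖ : ℝ) * W.realPeriodRat = plusPeriod f →
      ∃ n : ℕ, ‖PowerSeries.coeff n
        (PowerSeries.C (ϖ : ℚ_[p]) * padicLFunction f (unitRoot W p : ℚ_[p]))‖ = 1)
    (hSch9 : ClassX9 W p → ∀ Dh : PAdicHeightData W p, Dh.IsCanonical → SchneiderConjecture Dh)
    (hSchN : ∀ (q : ℚ_[p]) (Dh : PAdicHeightData W p), q ≠ 0 → ‖q‖ < 1 → tateJ q = (W.j : ℚ_[p]) →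
      IsMultCanonical Dh q → SchneiderConjecture Dh)
    (hSchS : ∀ (Dq : TateParameterData W p) (Dh : PAdicHeightData W p),
      IsSplitMultCanonical Dh Dq → SchneiderConjecture Dh)
    (hμ11 : ClassX11a W p ∨ (ClassX11b W p ∧ ¬ Ram W p) → Surj W p → X11a.MuAnZeroAt W p) :
    BSDp W p ∨ (ClassX1 W p ∧ ¬ GVPar W p) ∨ (ClassX11a W p ∧ ¬ Surj W p) ∨
      (ClassX2 W p ∧ ¬ (W.analyticRank = 0 ∧ GVPar W p) ∧
        ¬ (W.analyticRank = 1 ∧ ¬ W.HasSplitMultiplicativeReductionAtPrime p ∧ GVPar W p)) ∨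
      (ClassX11b W p ∧ ¬ Ram W p ∧ (¬ Surj W p ∨
        (W.HasSplitMultiplicativeReductionAtPrime p ∧
          ¬ ∃ (m : ℕ) (_ : Fact m.Prime), m ≠ p ∧ W.HasMultiplicativeReductionAtPrime m))) :=
  bsdp_or_corner_goodOrd_or_mult_of_five_le_certificates hBCS hBCSa hGZK hCGS hGVg hGr hmod hmodP hS
    hPR hΩ hSk hA hD hT hT'
    (X2.NonPrimitiveLambdaInvariantMultiplicativeDerived.lambda_nonPrimitive_eq_add_sum_delta_multiplicative_of_datum
      h23 hT hT' hInf)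
    hB hF hLiftF hP exists_characterLFunction_holds h311 hLC hLD hWu hJs hJn hHs hHn hGS hHida hMTT h311e
    hT1a hT2 hT1b h61 h326 hKato hcm hr h5 hdom hcert1 hμ9 hcert9 hSch9 hSchN hSchS hμ11

end Curve

end Summit.BirchSwinnertonDyer.Rank1Residual
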